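import Summits.AnomalousDissipation.AnomalousDissipation.Theorems.BaireTransferRobustLoudUpgradeLoudCategory
import Summits.AnomalousDissipation.AnomalousDissipation.Theorems.BaireTransferRobustLoudUpgradeStubCorrRange
import Summits.AnomalousDissipation.AnomalousDissipation.Theorems.BaireTransferRobustLoudUpgradeStubCorrGraphClosed
import Summits.AnomalousDissipation.AnomalousDissipation.Theorems.BaireTransferRobustLoudUpgradeStubWindowExhaust2
import Summits.AnomalousDissipation.AnomalousDissipation.Theorems.BaireTransferRobustLoudUpgradeStubLhcInterior
import Literature.Topology.FortLowerHemicontinuity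

/-!
# GENERIC PERSISTENCE of loudness for ALL witnesses (steady or time-periodic, any mean): the periodic twin of the c15
# `CategoryGeneric` package (crux `BaireTransfer.RobustLoudUpgrade`, stmt-AnomalousDissipation-1144; line `malkin-cone-group-orbits`, lead c16)

For a finite frequency family `S` let `𝚽[S,n] : P_S → Set (ℝ × ℝ × (ℝ³ × ℓ²))` be the BUDGET-FREE LATTICE-TEMPERED CORRESPONDENCE of the
window `n`: to `c` the set of data `(ν, τ, m, x)` — viscosity, period, mean, weighted space–time lattice state `x = Λû ∈ ℓ²(ℤ × ℤ³; ℂ³)` — of the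
classical `τ`-periodic solutions of `NS_ν(f_c)` with `ν, τ ∈ [1/(n+1), n+1]`, `‖m‖ ≤ n+1`, `Σ Λ‖x‖² ≤ n+1` (file-local notation below).  By the
landed wave-2 stubs its values lie in ONE compact set (`Tempered.stub_corrRange`, lattice Rellich) and its graph is closed
(`Tempered.stub_corrGraphClosed`, the compactness-of-tempered-orbits theorem of `…TemperedClosed.lean`), so it is UPPER HEMICONTINUOUS; FORT'S
THEOREM (`Literature.Topology.isMeagre_setOf_not_lowerHemicontinuousAt`, applied to the corestriction to the compact metric — hence second-countable —
range) makes it LOWER hemicontinuous off a meagre set; and at a point of lower hemicontinuity every STRICTLY loud witness in the window forces a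
whole neighbourhood of loud forces (`Tempered.stub_lhcInterior`: nearby data ⇒ nearby budgets by the slice `H¹` bound).  Hence:

* `genericPeriodic_interior` — **for every `S` there is a RESIDUAL, BUDGET-FREE set `G ⊆ P_S` such that for ALL ceilings `a` and budgets
  `E, ε`, every `c ∈ G` carrying a classical time-periodic solution of `NS_ν(f_c)` at some `ν ∈ (0,a)` (any period, any mean; steady states
  included) with `meanEnergy < E`, `meanDissipation > ε` is an INTERIOR point of `loud S a E ε`** — persistence WITHOUT any nondegeneracy hypothesis,
  generically in the force (c15 proved the mean-zero/any-mean STEADY case, `Category.genericSteady_interior`, `genericSteadyAll_interior`);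
* `loud_inter_generic_subset_interior` — on `G` the upgrade holds with INTERIOR and ARBITRARILY SMALL budget relaxation:
  `loud S a E ε ∩ G ⊆ interior (loud S a E' ε')` whenever `E < E'`, `ε' < ε`;
* `crux_residual_subset_compl_generic` — **every counterexample force to the crux is NON-GENERIC**: for `0 < E`, `0 < ε` and every level `j`,
  `LOUD_j(S,E,ε) ∖ closure (interior LOUD_j(S,2E,ε/2)) ⊆ Gᶜ` (a meagre set — consistent with `Tempered.isMeagre_loud_diff_closure_interior_relaxed`).

References: M. K. Fort, Publ. Math. Debrecen 2 (1951) Thm 2 (`Literature/Topology/FortLowerHemicontinuity.lean`); G. Iooss, Arch. Rational Mech.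
Anal. 47 (1972); D. Henry, LNM 840 (1981) Ch. 8 (the space–time lattice theory `Literature/Analysis/FluidPDE/TimePeriodicNSLattice*.lean`); the
census `Cruxes/RobustLoudUpgrade/STRATEGY-CENSUS.md` (W1: wild = expected-codimension-(−1) coincidences; here: wild forces are Fort-non-generic).
-/

set_option linter.dupNamespace false

noncomputable section

open scoped BigOperators Topology ENNReal NNReal ComplexConjugate
open Filter Set Function TopologicalSpace MeasureTheory UnitAddTorus

namespace Summit.AnomalousDissipation.AnomalousDissipation.Theorems.RobustLoudUpgrade.Tempered

open Literature.Analysis.FunctionSpaces Literature.Analysis.FunctionSpaces.Torus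
open Literature.Analysis.FunctionSpaces.EuclideanSpace
open Literature.Analysis.FluidPDE Literature.Analysis.FluidPDE.ScalarFourier
open Literature.Analysis.FluidPDE.TimePeriodicLattice
open Summit.AnomalousDissipation.AnomalousDissipation.Theses.BaireTransfer
open Summit.AnomalousDissipation.AnomalousDissipation.Theorems.RobustLoudUpgrade

-- NOTATION START (verbatim the local notations of `Literature/Analysis/FluidPDE/PeriodicNSOrbitPersistsProofs.lean`)
/-- The flat unit torus `T³`. -/
local notation "𝕋³" => UnitAddTorus (Fin 3)
/-- Real velocity values. -/
local notation "ℝ³" => EuclideanSpace ℝ (Fin 3)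
/-- Complex coefficient values. -/
local notation "ℂ³" => EuclideanSpace ℂ (Fin 3)

/-- Local notation: the parabolic weight `Λ(n, k) = |n| + |k|²`. -/
local notation:max "Λ" m:max => (|((Prod.fst m : ℤ) : ℝ)| + freqNormSq (Prod.snd m))

/-- Local notation: the convective symbol on `ℤ × ℤ³` (as in `TimePeriodicNSLattice`). -/
local notation:max "𝐍[" a ", " b "]" m:max =>
  (WithLp.toLp 2 (fun p : Fin 3 => ∑ j : Fin 3, ∑' m' : ℤ × (Fin 3 → ℤ),
    a m' j * (dsym j (Prod.snd m - Prod.snd m') * b (m - m') p)) : EuclideanSpace ℂ (Fin 3))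

/-- Local notation: division by the weight. -/
local notation:max "𝐜" x:max => (fun mm : ℤ × (Fin 3 → ℤ) =>
  ((((|((Prod.fst mm : ℤ) : ℝ)| + freqNormSq (Prod.snd mm))⁻¹ : ℝ) : ℂ) • x mm))

/-- Local notation: multiplication by the weight. -/
local notation:max "𝐬" x:max => (fun mm : ℤ × (Fin 3 → ℤ) =>
  ((((|((Prod.fst mm : ℤ) : ℝ)| + freqNormSq (Prod.snd mm)) : ℝ) : ℂ) • x mm))

/-- Local notation: the family of coefficients of `x ∈ W ⊂ ℓ²`. -/
local notation:max "𝐰" x:max =>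
  (((x : lp (fun _ : ℤ × (Fin 3 → ℤ) => EuclideanSpace ℂ (Fin 3)) 2)) : ℤ × (Fin 3 → ℤ) → EuclideanSpace ℂ (Fin 3))

/-- Local notation: the symbol `σ_om(n,k) = 2πi om n + 4π²ν|k|² + 2πi m₀·k`. -/
local notation "σ[" om ", " ν ", " m₀ "]" => (fun mm : ℤ × (Fin 3 → ℤ) =>
  2 * Real.pi * Complex.I * ((om : ℝ) : ℂ) * ((Prod.fst mm : ℤ) : ℂ) +
    (((4 * Real.pi ^ 2 * ν * freqNormSq (Prod.snd mm) : ℝ)) : ℂ) +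
    2 * Real.pi * Complex.I * (∑ jj : Fin 3, ((m₀ jj : ℝ) : ℂ) * (((Prod.snd mm) jj : ℤ) : ℂ)))

/-- Local notation: the lattice family of the orbit `u` with period `τ`:
`û(n,k) = 𝓕(complexify ∘ (timeRoll τ u − ∫ u(0)))(n,k)`. -/
local notation:max "𝐨[" τ ", " u "]" => (fun mm : ℤ × (Fin 3 → ℤ) =>
  mFourierCoeff (EuclideanSpace.complexify ∘ fun y : UnitAddTorus (Fin 4) => Torus.timeRoll τ u y - ∫ x, u 0 x)
    (Fin.cons (Prod.fst mm) (Prod.snd mm) : Fin 4 → ℤ))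

/-- Local notation: the force family `y_F(n,k) = [k ≠ 0][n = 0] 𝓕(complexify ∘ F)(k)`. -/
local notation:max "𝐲" F:max => (fun mm : ℤ × (Fin 3 → ℤ) =>
  (ite (Prod.snd mm = 0) (0 : EuclideanSpace ℂ (Fin 3))
    (ite (Prod.fst mm = 0) (mFourierCoeff (EuclideanSpace.complexify ∘ F) (Prod.snd mm)) 0)))

/-- Local notation: the family of coefficients of an element of `ℓ²(ℤ × ℤ³; ℂ³)`. -/
local notation:max "𝐯" x:max =>
  ((x : lp (fun _ : ℤ × (Fin 3 → ℤ) => EuclideanSpace ℂ (Fin 3)) 2) : ℤ × (Fin 3 → ℤ) → EuclideanSpace ℂ (Fin 3))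

/-- Local notation: the BUDGET-FREE LATTICE-TEMPERED CORRESPONDENCE of the window `n` — to a coefficient vector `c` the set of data
`(ν, τ, m, x)` (viscosity, period, mean, weighted lattice state `x = Λû ∈ ℓ²`) of the classical time-periodic solutions of `NS_ν(f_c)`
with `ν, τ ∈ [1/(n+1), n+1]`, `‖m‖ ≤ n+1`, `Σ Λ‖x‖² ≤ n+1`. -/
local notation "𝚽[" S ", " n "]" => (fun c : Coeff S => setOf
  (fun q : ℝ × ℝ × (EuclideanSpace ℝ (Fin 3) × lp (fun _ : ℤ × (Fin 3 → ℤ) => EuclideanSpace ℂ (Fin 3)) 2) =>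
    1 / ((n : ℝ) + 1) ≤ (Prod.fst q) ∧ (Prod.fst q) ≤ (n : ℝ) + 1 ∧ 1 / ((n : ℝ) + 1) ≤ (Prod.fst (Prod.snd q)) ∧ (Prod.fst (Prod.snd q)) ≤ (n : ℝ) + 1 ∧
    ‖(Prod.fst (Prod.snd (Prod.snd q)))‖ ≤ (n : ℝ) + 1 ∧
    (∑' mm : ℤ × (Fin 3 → ℤ), ENNReal.ofReal (Λ mm) * ‖(𝐯 ((Prod.snd (Prod.snd (Prod.snd q))))) mm‖ₑ ^ 2) ≤ ENNReal.ofReal ((n : ℝ) + 1) ∧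
    ∃ (u : ℝ → UnitAddTorus (Fin 3) → EuclideanSpace ℝ (Fin 3)) (p : ℝ → UnitAddTorus (Fin 3) → ℝ),
      IsClassicalNSSolutionOn Set.univ (Prod.fst q) (fun _ => force S c) u p ∧ Function.Periodic u (Prod.fst (Prod.snd q)) ∧
      (∫ y, u 0 y) = (Prod.fst (Prod.snd (Prod.snd q))) ∧ 𝐯 ((Prod.snd (Prod.snd (Prod.snd q)))) = 𝐬 𝐨[(Prod.fst (Prod.snd q)), u]))
-- NOTATION END

/-! ## §1 The generic set and the main theorem -/

/-- **GENERIC ROBUSTNESS OF ALL LOUD WITNESSES** (registered stub `stub_genericPeriodic` of skeleton c16 = registered sub-goal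
`genericPeriodic_interior`; lead's assembly of wave 2, def-free existential form): for every
frequency family `S` there is a RESIDUAL set `G ⊆ P_S` of forces — the common lower-hemicontinuity points of the budget-free correspondences
`𝚽[S,n]` (Fort's theorem on their compact corestrictions, `stub_corrRange` + `stub_corrGraphClosed` ⇒ upper hemicontinuity) — such that
for ALL ceilings `a` and budgets `E, ε`: every `c ∈ G` carrying a classical time-periodic solution of `NS_ν(f_c)` at some `ν ∈ (0,a)` (any
mean, any period) with `meanEnergy < E` and `meanDissipation > ε` is an INTERIOR point of `loud S a E ε` (`stub_windowExhaust2` +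
`stub_lhcInterior`). [folklore] -/
theorem genericPeriodic_interior : ∀ (S : Finset (Fin 3 → ℤ)), ∃ G : Set (Coeff S), G ∈ residual (Coeff S) ∧
    ∀ (a E ε : ℝ) (c : Coeff S), c ∈ G → ∀ (ν τ : ℝ) (u : ℝ → 𝕋³ → ℝ³) (p : ℝ → 𝕋³ → ℝ), 0 < ν → ν < a → 0 < τ →
      IsClassicalNSSolutionOn Set.univ ν (fun _ => force S c) u p → Function.Periodic u τ →
        meanEnergy u < E → ε < meanDissipation ν u → c ∈ interior (loud S a E ε) := by
  intro S
  refine ⟨⋂ n : ℕ, {c | LowerHemicontinuousAt 𝚽[S, n] c}, ?_, ?_⟩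
  · refine (countable_iInter_mem (ι := ℕ)).2 fun n => ?_
    -- the correspondence of the window `n` is upper hemicontinuous: closed graph into one compact set
    obtain ⟨K, hK, hΦK⟩ := stub_corrRange S n
    have hgraph := stub_corrGraphClosed S n
    have huhc : UpperHemicontinuous 𝚽[S, n] := by
      refine upperHemicontinuous_iff.2 fun c₀ => ?_
      refine UpperHemicontinuousAt.of_sequences hK.isSeqCompact (Eventually.of_forall fun c => hΦK c) ?_
      intro cs hcs qs hqs q₀ hq
      have hmem : (c₀, q₀) ∈ {cq : Coeff S × (ℝ × ℝ × (EuclideanSpace ℝ (Fin 3) ×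
          lp (fun _ : ℤ × (Fin 3 → ℤ) => EuclideanSpace ℂ (Fin 3)) 2)) | cq.2 ∈ 𝚽[S, n] cq.1} :=
        hgraph.mem_of_tendsto (hcs.prodMk_nhds hq) (Eventually.of_forall fun i => hqs i)
      exact hmem
    -- Fort's theorem on the compact corestriction (a compact metric space is second countable and regular)
    haveI : CompactSpace K := isCompact_iff_compactSpace.mp hK
    haveI : SecondCountableTopology K := EMetric.secondCountable_of_sigmaCompact K
    have hrange : IsClosed (Set.range (Subtype.val : K → ℝ × ℝ × (EuclideanSpace ℝ (Fin 3) ×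
        lp (fun _ : ℤ × (Fin 3 → ℤ) => EuclideanSpace ℂ (Fin 3)) 2))) := by
      rw [Subtype.range_coe]; exact hK.isClosed
    have huhc' : UpperHemicontinuous (fun c : Coeff S => (Subtype.val : K → _) ⁻¹' (𝚽[S, n] c)) :=
      huhc.isInducing_comp Topology.IsInducing.subtypeVal hrange
    have hmeagre : IsMeagre {c : Coeff S | ¬ LowerHemicontinuousAt (fun c : Coeff S => (Subtype.val : K → _) ⁻¹' (𝚽[S, n] c)) c} :=
      Literature.Topology.isMeagre_setOf_not_lowerHemicontinuousAt huhc'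
    -- lower hemicontinuity descends from the corestriction
    have htrans : ∀ c : Coeff S, LowerHemicontinuousAt (fun c : Coeff S => (Subtype.val : K → _) ⁻¹' (𝚽[S, n] c)) c →
        LowerHemicontinuousAt 𝚽[S, n] c := by
      intro c h
      rw [lowerHemicontinuousAt_iff] at h ⊢
      intro U hU hne
      obtain ⟨q, hqΦ, hqU⟩ := hne
      have h' := h (Subtype.val ⁻¹' U) (hU.preimage continuous_subtype_val) ⟨⟨q, hΦK c hqΦ⟩, hqΦ, hqU⟩
      exact h'.mono fun c' ⟨q', hq'Φ, hq'U⟩ => ⟨q'.1, hq'Φ, hq'U⟩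
    exact Filter.mem_of_superset hmeagre fun c hc => htrans c (not_not.1 hc)
  · intro a E ε c hc ν τ u p hν hνa hτ hsol hper hE hD
    obtain ⟨n, x, hmem, hx⟩ := stub_windowExhaust2 S c ν τ u p hν hτ hsol hper
    exact stub_lhcInterior S n a E ε c (Set.mem_iInter.1 hc n) ν τ u p x hν hνa hτ hsol hper hmem hx hE hD


/-! ## §2 Consequences: the upgrade with interior on the generic set; counterexample forces are non-generic -/

/-- **On the generic set the upgrade holds with INTERIOR and arbitrarily small budget relaxation**: for every `S` there is a residual
`G ⊆ P_S` with `loud S a E ε ∩ G ⊆ interior (loud S a E' ε')` for all `a` and all `E < E'`, `ε' < ε`. [folklore] -/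
theorem loud_inter_generic_subset_interior : ∀ (S : Finset (Fin 3 → ℤ)), ∃ G : Set (Coeff S), G ∈ residual (Coeff S) ∧
    ∀ (a E E' ε ε' : ℝ), E < E' → ε' < ε → loud S a E ε ∩ G ⊆ interior (loud S a E' ε') := by
  intro S
  obtain ⟨G, hG, h⟩ := genericPeriodic_interior S
  refine ⟨G, hG, fun a E E' ε ε' hE hε c hc => ?_⟩
  obtain ⟨⟨ν, hν, hνa, τ, u, p, hτ, hsol, hper, hEu, hεu⟩, hcG⟩ := hc
  exact h a E' ε' c hcG ν τ u p hν hνa hτ hsol hper (lt_of_le_of_lt hEu hE) (lt_of_lt_of_le hε hεu)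

/-- **Every counterexample force to the crux is NON-GENERIC**: for every `S` there is a residual `G ⊆ P_S` (the same budget-free set) such that
for `0 < E`, `0 < ε` and every level `j` the would-be counterexamples `LOUD_j(S,E,ε) ∖ closure (interior LOUD_j(S,2E,ε/2))` lie in the meagre set
`Gᶜ`. [folklore] -/
theorem crux_residual_subset_compl_generic : ∀ (S : Finset (Fin 3 → ℤ)), ∃ G : Set (Coeff S), G ∈ residual (Coeff S) ∧
    ∀ (E ε : ℝ), 0 < E → 0 < ε → ∀ j : ℕ,
      loud S (1 / ((j : ℝ) + 1)) E ε \ closure (interior (loud S (1 / ((j : ℝ) + 1)) (2 * E) (ε / 2))) ⊆ Gᶜ := by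
  intro S
  obtain ⟨G, hG, h⟩ := loud_inter_generic_subset_interior S
  refine ⟨G, hG, fun E ε hE hε j c hc hcG => hc.2 ?_⟩
  exact subset_closure (h _ E (2 * E) ε (ε / 2) (by linarith) (by linarith) ⟨hc.1, hcG⟩)

/-- **The generic set is dense**: in particular robustly loud forces (interior points of the relaxed loud set) accumulate at every point of
`closure (loud S a E ε ∩ G)` — the crux holds AT every force that is a limit of GENERIC loud forces. [folklore] -/
theorem closure_loud_inter_generic_subset : ∀ (S : Finset (Fin 3 → ℤ)), ∃ G : Set (Coeff S), G ∈ residual (Coeff S) ∧ Dense G ∧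
    ∀ (a E E' ε ε' : ℝ), E < E' → ε' < ε → closure (loud S a E ε ∩ G) ⊆ closure (interior (loud S a E' ε')) := by
  intro S
  obtain ⟨G, hG, h⟩ := loud_inter_generic_subset_interior S
  exact ⟨G, hG, dense_of_mem_residual hG, fun a E E' ε ε' hE hε => closure_mono (h a E E' ε ε' hE hε)⟩

end Summit.AnomalousDissipation.AnomalousDissipation.Theorems.RobustLoudUpgrade.Tempered

end
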